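import Summits.HodgeConjecture.HodgeConjecture.Theorems.Q8SymplecticPowersTranscendentalPart
import Literature.AlgebraicGeometry.Motives.HodgeStructureHodgeVectorBlockQuotients
import Literature.AlgebraicGeometry.Motives.HodgeStructureHodgeVectorBlockHodgeNumbers
import Summits.HodgeConjecture.HodgeConjecture.Theorems.CyclicUnitaryPowersTraceFormHodgeOrthogonal
import HarnessLib

/-!
# Route `Q8SymplecticPowers`, programme K2Q — brick C-Q part 4: the transcendental part is `tr ∘ cup`-ORTHOGONAL
# to the Hodge classes (`Hdg¹(H²X) ⊥_{tr∘cup} T`)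

Support file for crux K2Q `PowersHodgeOfQuaternionCommutators` (stmt-HodgeConjecture-24191; `--supports … --as helper`;
nothing here closes an item).  Prover seat `hodge-nonav-20241-p1` (g20).

For a smooth projective surface `X`, `H = H²(X; ℚ)` with its Hodge structure `hodge _ hX 2`, `N = Hdg¹(H)` its Hodge classes
and `T = N^{⊥ψ}` the transcendental part (the orthogonal of `N` for ANY polarisation `ψ`; canonical, brick C-Q3), the
INTERSECTION form `Q(x, y) = tr(x ∪ y)` — the form of the route's `Uni` clause, which is NOT a polarisation — satisfies

* **`tr_cup_eq_zero_of_mem_orthogonal_hodgeClasses`** — `Q(t, n) = 0` and `Q(n, t) = 0` for `t ∈ T`, `n ∈ N`; block form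
  `tr_cup_add_add`.

Proof: for `n ∈ N` the functional `x ↦ Q(x, n)` is a MORPHISM of Hodge structures `H → ℚ(-1)` (pure type
`(1,1)`): its complexification kills `F²H_ℂ` because `n ⊗ 1 ∈ F¹` and `Q_ℂ(F², F¹) = 0` (route A's landed
`CyclicUnitaryPowersTraceFormHodgeOrthogonal.stub_traceFormHodgeOrthogonal`, imported — the theses-cone warning is known); and every morphism from `H` to a pure
`(1,1)` structure kills `T = Hdg¹^{⊥ψ}` (`Polarization.orthogonal_hodgeClasses_le_ker_of_hodgeClasses_eq_top`, Voisin 2025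
Cor. 2.12).  Consequence used downstream (brick E-Q): the extension `id_N ⊕ g` of a `Q|_T`-isometry `g` of `T` is a
`Q`-isometry of `H`, so the `ℚ`-points of the quaternionic-unitary centraliser of `T` extend to elements of `Uni`.
HONEST FRAMING: pure Hodge-theoretic bookkeeping (axioms standard); item 24191 OPEN; nothing here says HC ∕ HC_CM ∕ HC_AV is
proved.

## References

* C. Voisin, *Hodge Theory and Complex Algebraic Geometry I* (2002), §6.1, §7.1.2 Lemma 7.26, §7.3.1 Def. 7.22.
  [cite: VoisinHodgeI2002]
* C. Voisin, *Hodge structures and the topology of algebraic varieties* (2025), Cor. 2.12. [cite: Voisin2025]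
* D. Huybrechts, *Lectures on K3 surfaces* (2016), Ch. 3 Def. 2.5 and Lemma 3.1 (`T(X) = NS(X)^⊥`). [cite: Huybrechts2016K3]
-/

set_option linter.dupNamespace false

noncomputable section

open scoped TensorProduct
open CategoryTheory
open Literature.AlgebraicGeometry.Motives Literature.AlgebraicGeometry.HodgeTheory
open Literature.AlgebraicGeometry.HodgeTheory.BettiUniverse
open Literature.AlgebraicGeometry.Motives.HodgeStructure
open Literature.AlgebraicTopology.SingularHomology

namespace Summit.HodgeConjecture.HodgeConjecture.Theorems.Q8SymplecticPowersTranscendentalOrthogonal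

variable {X : SchemeOver ℂ}

/-- The complexification of the functional `x ↦ Q(x, n)` is `z ↦ Q_ℂ(z, n ⊗ 1)` (read in `ℂ ⊗_ℚ ℚ = ℂ`). [folklore] -/
theorem rid_baseChange_flip_apply {M : Type*} [AddCommGroup M] [Module ℚ M] (Q : M →ₗ[ℚ] M →ₗ[ℚ] ℚ) (n : M)
    (z : ℂ ⊗[ℚ] M) :
    TensorProduct.AlgebraTensorModule.rid ℚ ℂ ℂ (((LinearMap.flip Q n).baseChange ℂ) z) =
      LinearMap.BilinForm.baseChange ℂ Q z ((1 : ℂ) ⊗ₜ[ℚ] n) := by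
  induction z using TensorProduct.induction_on with
  | zero => rw [map_zero, map_zero, map_zero, LinearMap.zero_apply]
  | tmul a m =>
    rw [LinearMap.baseChange_tmul, TensorProduct.AlgebraTensorModule.rid_tmul, LinearMap.flip_apply,
      LinearMap.BilinForm.baseChange_tmul, mul_one]
  | add z z' hz hz' => rw [map_add, map_add, hz, hz', map_add, LinearMap.add_apply]

/-- **The transcendental part is `tr ∘ cup`-orthogonal to the Hodge classes: `tr(t ∪ n) = 0` for `t ∈ T = Hdg¹(H²X)^{⊥ψ}` and
`n ∈ Hdg¹(H²X)`** (any polarisation `ψ`).  The functional `Q(·, n) : H²(X) → ℚ(-1)` is a morphism of Hodge structures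
(`Q_ℂ(F², n ⊗ 1) = 0` as `n ⊗ 1 ∈ F¹`), and morphisms to a pure `(1,1)` structure kill `Hdg¹^{⊥ψ}`.
[cite: Voisin2025, Cor. 2.12] [cite: VoisinHodgeI2002, §7.1.2 Lemma 7.26 and §7.3.1 Def. 7.22]
[cite: Huybrechts2016K3, Ch. 3 Lemma 3.1] -/
theorem tr_cup_eq_zero_of_mem_orthogonal_hodgeClasses (hX : IsSmoothProjective 2 X)
    (ψ : Polarization (hodge exists_isReal_hodgeModel_holds hX 2)) {t n : bettiCohomology X 2}
    (ht : t ∈ ψ.form.orthogonal ((hodge exists_isReal_hodgeModel_holds hX 2).hodgeClasses 1))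
    (hn : n ∈ (hodge exists_isReal_hodgeModel_holds hX 2).hodgeClasses 1) :
    tr hX (2 + 2) (cup X 2 2 t n) = 0 := by
  haveI := finite hX 2
  have hw : (((2 : ℕ) : ℤ)) = 2 * 1 := by norm_num
  -- the morphism of Hodge structures `x ↦ tr(x ∪ n) : H²(X) → ℚ(-1)`
  let f : Hom (hodge exists_isReal_hodgeModel_holds hX 2) (HodgeStructure.pure ℚ 1 ((2 : ℕ) : ℤ) hw) :=
    { toLinearMap := LinearMap.flip ((cup X 2 2).compr₂ (tr hX (2 + 2))) n
      map_F_le := fun p => by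
        by_cases hp : p ≤ 1
        · rw [HodgeStructure.pure_F, HodgeStructure.pureFiltration_of_le hp]; exact le_top
        · rw [HodgeStructure.pure_F, HodgeStructure.pureFiltration_of_lt (not_le.1 hp), le_bot_iff,
            Submodule.eq_bot_iff]
          rintro _ ⟨z, hz, rfl⟩
          have hz2 : z ∈ (hodge exists_isReal_hodgeModel_holds hX 2).F 2 :=
            (hodge exists_isReal_hodgeModel_holds hX 2).antitone_F (show (2 : ℤ) ≤ p by omega) hz
          have hn1 : (1 : ℂ) ⊗ₜ[ℚ] n ∈ (hodge exists_isReal_hodgeModel_holds hX 2).F 1 :=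
            (HodgeStructure.mem_hodgeClasses_iff _ _ _).1 hn
          have h0 := CyclicUnitaryPowersTraceFormHodgeOrthogonal.stub_traceFormHodgeOrthogonal hX 2 1 _ _ hz2 hn1
            (by norm_num)
          apply (TensorProduct.AlgebraTensorModule.rid ℚ ℂ ℂ).injective
          rw [rid_baseChange_flip_apply, h0, map_zero] }
  have hker := ψ.orthogonal_hodgeClasses_le_ker_of_hodgeClasses_eq_top (show (1 : ℤ) + 1 = ((2 : ℕ) : ℤ) by norm_num) f
    (HodgeStructure.hodgeClasses_pure_eq_top ℚ 1 hw) ht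
  rw [LinearMap.mem_ker, LinearMap.flip_apply, LinearMap.compr₂_apply] at hker
  exact hker

/-- The symmetric form: **`tr(n ∪ t) = 0` for `n ∈ Hdg¹(H²X)`, `t ∈ Hdg¹^{⊥ψ}`** (graded commutativity in even degree).
[cite: Voisin2025, Cor. 2.12] [cite: VoisinHodgeI2002, §7.1.2 Lemma 7.26] -/
theorem tr_cup_eq_zero_of_mem_hodgeClasses_of_mem_orthogonal (hX : IsSmoothProjective 2 X)
    (ψ : Polarization (hodge exists_isReal_hodgeModel_holds hX 2)) {n t : bettiCohomology X 2}
    (hn : n ∈ (hodge exists_isReal_hodgeModel_holds hX 2).hodgeClasses 1)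
    (ht : t ∈ ψ.form.orthogonal ((hodge exists_isReal_hodgeModel_holds hX 2).hodgeClasses 1)) :
    tr hX (2 + 2) (cup X 2 2 n t) = 0 := by
  have h := bettiCup_gradedComm (cupProduct_gradedComm_holds ℚ (ComplexPoints X)) (rfl : 2 + 2 = 2 + 2) rfl n t
  have h1 : ((-1 : ℚ) ^ (2 * 2)) = 1 := by norm_num
  rw [h1, one_smul] at h
  rw [h]
  exact tr_cup_eq_zero_of_mem_orthogonal_hodgeClasses hX ψ ht hn

/-- **The `N ⊕ T` block form of the intersection form**: for `x = n + t`, `x' = n' + t'` along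
`H²(X; ℚ) = Hdg¹ ⊕ Hdg¹^{⊥ψ}`, `tr(x ∪ x') = tr(n ∪ n') + tr(t ∪ t')`. [cite: VoisinHodgeI2002, §7.1.2 Lemma 7.26]
[cite: Huybrechts2016K3, Ch. 3 Lemma 3.1] -/
theorem tr_cup_add_add (hX : IsSmoothProjective 2 X)
    (ψ : Polarization (hodge exists_isReal_hodgeModel_holds hX 2)) {n n' t t' : bettiCohomology X 2}
    (hn : n ∈ (hodge exists_isReal_hodgeModel_holds hX 2).hodgeClasses 1)
    (hn' : n' ∈ (hodge exists_isReal_hodgeModel_holds hX 2).hodgeClasses 1)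
    (ht : t ∈ ψ.form.orthogonal ((hodge exists_isReal_hodgeModel_holds hX 2).hodgeClasses 1))
    (ht' : t' ∈ ψ.form.orthogonal ((hodge exists_isReal_hodgeModel_holds hX 2).hodgeClasses 1)) :
    tr hX (2 + 2) (cup X 2 2 (n + t) (n' + t')) =
      tr hX (2 + 2) (cup X 2 2 n n') + tr hX (2 + 2) (cup X 2 2 t t') := by
  simp only [map_add, LinearMap.add_apply, tr_cup_eq_zero_of_mem_hodgeClasses_of_mem_orthogonal hX ψ hn ht',
    tr_cup_eq_zero_of_mem_orthogonal_hodgeClasses hX ψ ht hn', add_zero, zero_add]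

end Summit.HodgeConjecture.HodgeConjecture.Theorems.Q8SymplecticPowersTranscendentalOrthogonal

end
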